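import Literature.MathematicalPhysics.QuantumFieldTheory.Balaban1983to89.Node00.TorusCoverSUGaugeLocal

/-!
# NODE 00 — FILE 3b″: the `U(N) → SU(N)` NORMALISATION OF FILE 3b′ WITH ITS PHASE EXPORTED — `s = μ⁻¹·g`, `‖μ‖ = 1`, `μ^N = det g`, the per-bond law
# `μ(x)⁻¹μ(x+e_μ) = e^{−iη Re tr A(b)∕N}` — and the `SU(N)`-IN ∕ `SU(N)`-OUT case where the phase is `1` and the exponent is already traceless

Cell `pub-ymgap`, width seat `pub-ymgap-dag-n07-w3` generation 8 (LEAD PEN of plan g90's SPEC D90-S3W1 (P1)(iii); my g7 HANDOFF «SUCCESSOR's FIRST ITEM (i): with-phase edition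
of `exists_suGauge_of_unitaryGauge_local`»; Stage-0 reply v2 `HOME/pub-ymgap-dag-n07-w3/SPEC-REPLY-P1iii.md` §1b (g) ∕ fork N1: the S3 door must EXPORT how the torus gauge is made
from [6] Proposition 6's member gauge).  NEW leaf; CONSUMED BY NAME, nothing modified: my g7 FILE 3b′ `Node00.TorusCoverSUGaugeLocal` (its proof is re-run VERBATIM with a longer
conclusion), dag-n07-e's FILE 3b `Node00.TorusCoverSUGauge` (`det_val_cfgExp`, `trace_eq_re_of_isSelfAdjoint`, `norm_trace_le_card_mul`, `norm_det_eq_one_of_mem_unitaryUnits`,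
`smul_mem_specialUnitaryGroup`, `val_cfgExp_traceless`, `traceless`), FILE 3a ∕ 3a′ (`stairSum`, `lam_eq_mul_exp_stairSum`, `stairSum_add_e_sub_eq_local`).
`--kind proof --supports stmt-QuantumFields-27364` (K1⁹; count-neutral helper).  [6] = [Balaban1985RegularSpaces]; [3] = [Balaban1985Averaging]; [15] = [Balaban1985Variational].

WHY.  The torus doors of this lineage (g0–g7) deliver [15] (152)–(153) from [6] Prop. 6's `U(N)`-valued member gauge `u_m` (N05's `Node00.GaugedBoundB8`) by normalising
`w⁻¹ = u_m⁻¹·v_fix` to `SU(N)` (FILE 3b′) — and then FORGET the relation between the torus gauge `s` and `u_m`.  The K0 knit's normalisation predicate `Nrm` ([15] (152)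
«ū_j = 1 on Λ′_j», MODULE 59 of dag-n07-e, abstract in the knit) is a condition on the quotient `v·s⁻¹` of a representative's gauge by the Landau gauge; whatever text of record is
ruled (Stage-0 reply fork N1∕…), its door must READ `s` in terms of `u_m` — so the phase `μ` of FILE 3b′'s construction (`s = μ⁻¹·w⁻¹`, `μ = c·e^{iΘ∕N}`, `Θ` the exact staircase
integral of the determinant angle) has to be exported, together with its two laws (`μ^N = det`, per-bond increment).  When the member gauge is ALREADY `SU(N)`-valued (the
`G`-valued γ-chain of dag-n05-e g33, `B8Prop6CubeMember*GammaG`), no phase is needed at all: §2.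

WHAT IS PROVED (kernel; `𝔸 = M_N(ℂ)`, `N ≥ 1`; elementary; no definition).
* §1 ★★★ `exists_suGauge_of_unitaryGauge_local_phase` — FILE 3b′'s theorem with the conclusion extended by `∃ μ : ℤᵈ → ℂ`: `‖μ‖ = 1` everywhere, `μ(y)^N = det g(y)` on the box,
  `ιSU (s y) = μ(y)⁻¹ • g(y)` on the box, `μ(x)⁻¹·μ(x + e_μ) = exp(−iη·Re tr A(x,μ)∕N)` on the box's bonds, and the gauge equation `V^{ιSU∘s} = e^{iη·traceless A}` as before.
* §2 ★★ `exists_suGauge_of_specialUnitaryGauge_local` — if `g` is `SU(N)`-valued on the box (and `det V = 1` on its bonds, `A` self-adjoint with the per-bond cap `η·N·‖A‖ ≤ τ`,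
  `4τ < 2π`): `tr A(b) = 0` on every bond of the box (the determinant of the gauge equation is `e^{iη tr A} = 1` with `|η tr A| ≤ τ < π∕2`), hence `traceless A = A` there and
  `s := g` itself serves: `ιSU (s y) = g(y)` on the box and `V^{ιSU∘s} = e^{iηA}` — NO phase; ★ `trace_eq_zero_of_gauge_su` (the trace identity alone).
HONEST FRAMING: elementary; nothing of Bałaban asserted or discharged; no token ∕ stub ∕ K-item closed; N07 ∕ N05 NOT discharged; counts unmoved; one finite 𝕋⁴ programme at fixed ε —
R4 closes the conditional finite-𝕋⁴ rung `BalabanLadder.UV` only; the YM mass gap (Clay) is NOT proved by any of this; nothing continuum ∕ ℝ⁴ ∕ OS.  No `sorry`, no `def`, no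
`instance`, no `notation`.

References: [Balaban1985RegularSpaces] Prop. 6 (1.135)–(1.138) p.99, p.76 («G = SU(N)»); [Balaban1985Averaging] (9) p.18, p.20; [Balaban1985Variational] (152) p.301.
-/

noncomputable section

namespace Literature.MathematicalPhysics.QuantumFieldTheory.Balaban1983to89.Node00

open scoped Matrix.Norms.L2Operator
open Complex (I)
open NormedSpace (exp)
open B7Prop1Explicit (e e_apply expUnit val_expUnit)
open B7Prop1Local (InBox)
open B7Prop2Explicit (unitaryUnits mem_unitaryUnits)
open B7Prop2SpecialUnitary (specialUnitaryUnits mem_specialUnitaryUnits)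
open B8Eq184Proof (cfgExp)

section Matrices

variable {N : ℕ} [NeZero N]

omit [NeZero N] in
/-- The determinant of the inverse unit is the inverse determinant (FILE 3b's private helper, re-stated). [folklore] -/
private theorem det_val_inv_units'' (u : (MatA N)ˣ) : ((u⁻¹ : (MatA N)ˣ) : MatA N).det = ((u : MatA N).det)⁻¹ := by
  have h := congrArg Matrix.det u.inv_mul
  rw [Matrix.det_mul, Matrix.det_one] at h
  exact eq_inv_of_mul_eq_one_left h

/-- The box predicate, coordinatewise. [folklore] -/
private theorem inBox_iff_forall'' {d : ℕ} (lo hi y : B7Prop1Explicit.Site d) : InBox lo hi y ↔ ∀ i, lo i ≤ y i ∧ y i ≤ hi i := Iff.rfl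

/-! ## §1  FILE 3b′ with the phase exported -/

/-- ★★★ **THE `U(N) → SU(N)` NORMALISATION UNDER THE PER-BOND WINDOW, WITH ITS PHASE** — my g7 `exists_suGauge_of_unitaryGauge_local` (same data: `det V(b) = 1` on the box's
bonds, `g` unitary on the box, `V^{g}(b) = e^{iηA(b)}` with `A(b)` self-adjoint, per-bond cap `η·N·‖A(b)‖ ≤ τ`, `4τ < 2π`) with the construction exported: a phase `μ : ℤᵈ → ℂ` with
`‖μ(y)‖ = 1`, `μ(y)^N = det g(y)` on the box, `ιSU(s(y)) = μ(y)⁻¹·g(y)` on the box, the per-bond law `μ(x)⁻¹μ(x+e_μ) = e^{−iη·Re tr A(x,μ)∕N}` on the box's bonds, and the gauge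
equation `V^{ιSU ∘ s}(b) = e^{iη·traceless(A(b))}`. [cite: Balaban1985RegularSpaces, Prop. 6 p.99, (1.136) p.99, (1.131) p.99; Balaban1985Averaging, (9) p.18, p.20; Balaban1985Variational, (152) p.301] -/
theorem exists_suGauge_of_unitaryGauge_local_phase {d : ℕ} (lo hi : B7Prop1Explicit.Site d) {η : ℝ} (hη : 0 ≤ η)
    (V : B7Prop1Explicit.Site d → Fin d → (MatA N)ˣ) (g : B7Prop1Explicit.Site d → (MatA N)ˣ) (A : B7Prop1Explicit.Site d → Fin d → MatA N) {τ : ℝ}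
    (hV : ∀ x μ, InBox lo hi x → InBox lo hi (x + e μ) → ((V x μ : (MatA N)ˣ) : MatA N).det = 1)
    (hg : ∀ x, InBox lo hi x → g x ∈ unitaryUnits (MatA N))
    (hgauge : ∀ x μ, InBox lo hi x → InBox lo hi (x + e μ) → B7Prop1Explicit.gaugeAct g V x μ = cfgExp η A x μ)
    (hsa : ∀ x μ, InBox lo hi x → InBox lo hi (x + e μ) → IsSelfAdjoint (A x μ))
    (hA : ∀ x μ, InBox lo hi x → InBox lo hi (x + e μ) → η * (N * ‖A x μ‖) ≤ τ)
    (hsmall : 4 * τ < 2 * Real.pi) :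
    ∃ s : B7Prop1Explicit.Site d → Matrix.specialUnitaryGroup (Fin N) ℂ, ∃ μf : B7Prop1Explicit.Site d → ℂ,
      (∀ y, ‖μf y‖ = 1) ∧
      (∀ y, InBox lo hi y → μf y ^ N = ((g y : (MatA N)ˣ) : MatA N).det) ∧
      (∀ y, InBox lo hi y → ((ιSU N (s y) : (MatA N)ˣ) : MatA N) = (μf y)⁻¹ • ((g y : (MatA N)ˣ) : MatA N)) ∧
      (∀ x μ, InBox lo hi x → InBox lo hi (x + e μ) → (μf x)⁻¹ * μf (x + e μ) = Complex.exp (-(I * ↑(η * ((A x μ).trace).re) / N))) ∧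
      (∀ x μ, InBox lo hi x → InBox lo hi (x + e μ) →
        B7Prop1Explicit.gaugeAct (fun y => ιSU N (s y)) V x μ = cfgExp η (fun y ν => traceless (A y ν)) x μ) := by
  classical
  have hNpos : 0 < N := NeZero.pos N
  have hN : (0 : ℝ) < N := Nat.cast_pos.2 hNpos
  -- empty box: nothing to prove
  by_cases hne : InBox lo hi lo
  swap
  · refine ⟨fun _ => 1, fun _ => 1, fun _ => by simp, fun y hy => (hne fun i => ⟨le_rfl, (hy i).1.trans (hy i).2⟩).elim,
      fun y hy => (hne fun i => ⟨le_rfl, (hy i).1.trans (hy i).2⟩).elim, fun x μ hx _ => (hne fun i => ⟨le_rfl, (hx i).1.trans (hx i).2⟩).elim,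
      fun x μ hx _ => (hne fun i => ⟨le_rfl, (hx i).1.trans (hx i).2⟩).elim⟩
  -- the determinant phase and its bond angles
  set lam : B7Prop1Explicit.Site d → ℂ := fun y => ((g y : (MatA N)ˣ) : MatA N).det with hlam
  set θ : B7Prop1Explicit.Site d → Fin d → ℝ := fun y μ => η * ((A y μ).trace).re with hθ
  have hlam1 : ∀ y, InBox lo hi y → ‖lam y‖ = 1 := fun y hy => norm_det_eq_one_of_mem_unitaryUnits (hg y hy)
  have hlam0 : ∀ y, InBox lo hi y → lam y ≠ 0 := fun y hy h => by
    have := hlam1 y hy; rw [h, norm_zero] at this; exact zero_ne_one this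
  -- Liouville: `λ(x+e_μ) = λ(x)·e^{−iθ(b)}`
  have hstep : ∀ y μ, InBox lo hi y → InBox lo hi (y + e μ) → lam (y + e μ) = lam y * Complex.exp (I * ↑(-θ y μ)) := by
    intro y μ hy hy'
    have h1 := congrArg (fun u : (MatA N)ˣ => (u : MatA N).det) (hgauge y μ hy hy')
    simp only [B7Prop1Explicit.gaugeAct, Units.val_mul, Matrix.det_mul, det_val_inv_units'', hV y μ hy hy', mul_one,
      det_val_cfgExp] at h1
    rw [trace_eq_re_of_isSelfAdjoint (hsa y μ hy hy')] at h1
    have h2 : lam y * (lam (y + e μ))⁻¹ = Complex.exp (I * θ y μ) := by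
      rw [hθ]; dsimp only; push_cast; rw [← mul_assoc]; exact h1
    have h3 : lam (y + e μ) ≠ 0 := hlam0 _ hy'
    have h4 : lam y ≠ 0 := hlam0 _ hy
    calc lam (y + e μ) = lam y * (lam y * (lam (y + e μ))⁻¹)⁻¹ := by field_simp
      _ = lam y * Complex.exp (I * ↑(-θ y μ)) := by rw [h2, ← Complex.exp_neg]; push_cast; ring_nf
  -- the bond angles are capped: `|θ(b)| ≤ ηN‖A(b)‖ ≤ τ`
  have hτ : ∀ y μ, InBox lo hi y → InBox lo hi (y + e μ) → |(-θ y μ)| ≤ τ := by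
    intro y μ hy hy'
    rw [abs_neg, hθ]
    dsimp only
    rw [abs_mul, abs_of_nonneg hη]
    refine le_trans (mul_le_mul_of_nonneg_left ?_ hη) (hA y μ hy hy')
    calc |((A y μ).trace).re| ≤ ‖(A y μ).trace‖ := Complex.abs_re_le_norm _
      _ ≤ N * ‖A y μ‖ := norm_trace_le_card_mul _
  -- the `N`-th root of the phase: `c^N = λ(lo)`, `μf y = c·e^{iS(y)∕N}`, `S = stairSum (−θ)`
  obtain ⟨c, hc⟩ := IsAlgClosed.exists_pow_nat_eq (lam lo) hNpos
  have hc1 : ‖c‖ = 1 := by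
    have h := congrArg (fun z : ℂ => ‖z‖) hc
    simp only [norm_pow, hlam1 lo hne] at h
    exact (pow_eq_one_iff_of_nonneg (norm_nonneg c) hNpos.ne').1 h
  set S : B7Prop1Explicit.Site d → ℝ := fun y => stairSum lo (fun y μ => -θ y μ) y with hS
  set μf : B7Prop1Explicit.Site d → ℂ := fun y => c * Complex.exp (I * ↑(S y) / N) with hμf
  have hμ1 : ∀ y, ‖μf y‖ = 1 := fun y => by
    rw [hμf]; dsimp only
    rw [norm_mul, hc1, one_mul, show (I * ↑(S y) / N : ℂ) = ↑(S y / N) * I by push_cast; ring, Complex.norm_exp_ofReal_mul_I]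
  have hμN : ∀ y, InBox lo hi y → μf y ^ N = lam y := by
    intro y hy
    rw [hμf]; dsimp only
    have hN' : (N : ℂ) ≠ 0 := by exact_mod_cast hNpos.ne'
    rw [mul_pow, hc, ← Complex.exp_nat_mul, lam_eq_mul_exp_stairSum hy hstep]
    congr 2
    simp only [hS]
    field_simp
  have hμ0 : ∀ y, μf y ≠ 0 := fun y h => by have := hμ1 y; rw [h, norm_zero] at this; exact zero_ne_one this
  -- exactness of the staircase phase on every bond of the box — FILE 3a′, per-bond window, NO width condition
  have hexact : ∀ y μ, InBox lo hi y → InBox lo hi (y + e μ) → S (y + e μ) - S y = -θ y μ := fun y μ hy hy' =>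
    stairSum_add_e_sub_eq_local hy hy' hstep hlam0 hτ hsmall
  -- the `SU(N)`-valued gauge
  have hmem : ∀ y, InBox lo hi y → (μf y)⁻¹ • ((g y : (MatA N)ˣ) : MatA N) ∈ Matrix.specialUnitaryGroup (Fin N) ℂ := fun y hy =>
    smul_mem_specialUnitaryGroup (hμ1 y) (mem_unitaryUnits.1 (hg y hy)) (hμN y hy)
  let s : B7Prop1Explicit.Site d → Matrix.specialUnitaryGroup (Fin N) ℂ := fun y =>
    if h : ∀ i, lo i ≤ y i ∧ y i ≤ hi i then ⟨(μf y)⁻¹ • ((g y : (MatA N)ˣ) : MatA N), hmem y h⟩ else 1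
  have hs : ∀ y, InBox lo hi y → ((ιSU N (s y) : (MatA N)ˣ) : MatA N) = (μf y)⁻¹ • ((g y : (MatA N)ˣ) : MatA N) := by
    intro y hy
    rw [coe_ιSU]
    simp only [s, dif_pos ((inBox_iff_forall'' lo hi y).1 hy)]
  have hsinv : ∀ y, InBox lo hi y → (((ιSU N (s y))⁻¹ : (MatA N)ˣ) : MatA N) = (μf y) • (((g y)⁻¹ : (MatA N)ˣ) : MatA N) := by
    intro y hy
    refine Units.inv_eq_of_mul_eq_one_right ?_
    rw [hs y hy, Matrix.smul_mul, Matrix.mul_smul, smul_smul, Units.mul_inv, inv_mul_cancel₀ (hμ0 y), one_smul]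
  -- the per-bond law of the phase: `μ(x)⁻¹·μ(x+e_μ) = e^{−iθ∕N}`
  have hratio : ∀ x μ, InBox lo hi x → InBox lo hi (x + e μ) →
      (μf x)⁻¹ * μf (x + e μ) = Complex.exp (-(I * ↑(η * ((A x μ).trace).re) / N)) := by
    intro x μ hx hx'
    have hc0 : c ≠ 0 := fun h => by rw [h, norm_zero] at hc1; exact zero_ne_one hc1
    have h1 : (μf x)⁻¹ * μf (x + e μ) = Complex.exp (I * ↑(S (x + e μ)) / N - I * ↑(S x) / N) := by
      rw [Complex.exp_sub, hμf]
      dsimp only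
      have he : Complex.exp (I * ↑(S x) / N) ≠ 0 := Complex.exp_ne_zero _
      field_simp
    rw [h1]
    congr 1
    have h2 : ((S (x + e μ) : ℝ) : ℂ) - ↑(S x) = -↑(θ x μ) := by
      rw [← Complex.ofReal_sub, hexact x μ hx hx']; push_cast; rfl
    calc I * ↑(S (x + e μ)) / ↑N - I * ↑(S x) / ↑N = I * (↑(S (x + e μ)) - ↑(S x)) / N := by ring
      _ = -(I * ↑(η * ((A x μ).trace).re) / N) := by rw [h2, hθ]; ring
  refine ⟨s, μf, hμ1, fun y hy => hμN y hy, hs, hratio, fun x μ hx hx' => ?_⟩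
  apply Units.ext
  have hval := congrArg (fun u : (MatA N)ˣ => (u : MatA N)) (hgauge x μ hx hx')
  simp only [B7Prop1Explicit.gaugeAct, Units.val_mul] at hval ⊢
  rw [hs x hx, hsinv (x + e μ) hx', Matrix.smul_mul, Matrix.smul_mul, Matrix.mul_smul, smul_smul, hval, hratio x μ hx hx', val_cfgExp_traceless]

/-! ## §2  `SU(N)` in, `SU(N)` out: no phase, exponent already traceless -/

/-- ★ **THE TRACE OF THE LANDAU EXPONENT VANISHES WHEN BOTH THE CONFIGURATION AND THE GAUGE ARE `SU(N)`-VALUED**: from `V^{g}(b) = e^{iηA(b)}` (`η > 0`) with `det V(b) = 1`,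
`det g(x) = det g(x+e_μ) = 1`, `A(b)` self-adjoint and the per-bond cap `η·N·‖A(b)‖ ≤ τ`, `4τ < 2π`: `e^{iη tr A(b)} = 1` with `|η·Re tr A(b)| ≤ τ < π∕2`, hence `tr A(b) = 0`.
[cite: Balaban1985RegularSpaces, p.76 («G = SU(N)»), (1.36) p.82; Balaban1985Averaging, (9) p.18, p.20] -/
theorem trace_eq_zero_of_gauge_su {d : ℕ} {η : ℝ} (hη : 0 < η) (V : B7Prop1Explicit.Site d → Fin d → (MatA N)ˣ) (g : B7Prop1Explicit.Site d → (MatA N)ˣ)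
    (A : B7Prop1Explicit.Site d → Fin d → MatA N) {τ : ℝ} (x : B7Prop1Explicit.Site d) (μ : Fin d)
    (hV : ((V x μ : (MatA N)ˣ) : MatA N).det = 1) (hgx : ((g x : (MatA N)ˣ) : MatA N).det = 1) (hgx' : ((g (x + e μ) : (MatA N)ˣ) : MatA N).det = 1)
    (hgauge : B7Prop1Explicit.gaugeAct g V x μ = cfgExp η A x μ) (hsa : IsSelfAdjoint (A x μ)) (hA : η * (N * ‖A x μ‖) ≤ τ) (hsmall : 4 * τ < 2 * Real.pi) :
    (A x μ).trace = 0 := by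
  have h1 := congrArg (fun u : (MatA N)ˣ => (u : MatA N).det) hgauge
  simp only [B7Prop1Explicit.gaugeAct, Units.val_mul, Matrix.det_mul, det_val_inv_units'', hV, hgx, hgx', mul_one, inv_one,
    det_val_cfgExp] at h1
  rw [trace_eq_re_of_isSelfAdjoint hsa] at h1 ⊢
  have hθ : |η * ((A x μ).trace).re| ≤ τ := by
    rw [abs_mul, abs_of_nonneg hη.le]
    refine le_trans (mul_le_mul_of_nonneg_left ?_ hη.le) hA
    calc |((A x μ).trace).re| ≤ ‖(A x μ).trace‖ := Complex.abs_re_le_norm _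
      _ ≤ N * ‖A x μ‖ := norm_trace_le_card_mul _
  have h2 : Complex.exp (↑(η * ((A x μ).trace).re) * I) = 1 := by
    have h1' : (1 : ℂ) = Complex.exp (I * ↑η * ↑((A x μ).trace.re)) := h1
    rw [h1']; congr 1; push_cast; ring
  obtain ⟨n, hn⟩ := Complex.exp_eq_one_iff.1 h2
  have hn' : η * ((A x μ).trace).re = n * (2 * Real.pi) := by
    have := congrArg Complex.im hn
    simpa using this
  have hpi : 0 < Real.pi := Real.pi_pos
  have hn0 : n = 0 := by
    by_contra hne
    have h1' : (1 : ℝ) ≤ |(n : ℝ)| := by exact_mod_cast Int.one_le_abs hne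
    have habs : |(n : ℝ)| * (2 * Real.pi) ≤ τ := by
      have h := hθ
      rw [hn', abs_mul, abs_of_pos (by positivity : (0 : ℝ) < 2 * Real.pi)] at h
      exact h
    nlinarith
  rw [hn0, Int.cast_zero, zero_mul] at hn'
  have hre : ((A x μ).trace).re = 0 := by
    rcases mul_eq_zero.1 hn' with h | h
    · exact absurd h hη.ne'
    · exact h
  rw [hre, Complex.ofReal_zero]

/-- ★★ **`SU(N)` IN, `SU(N)` OUT — NO PHASE**: if the member gauge `g` is ALREADY `SU(N)`-valued on the box (`det V(b) = 1` on its bonds, `V^{g}(b) = e^{iηA(b)}` with `A(b)`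
self-adjoint, per-bond cap `η·N·‖A(b)‖ ≤ τ`, `4τ < 2π`, `η > 0`), then `tr A(b) = 0` on every bond of the box and `s := g` serves VERBATIM: `ιSU(s(y)) = g(y)` on the box and
`V^{ιSU∘s}(b) = e^{iηA(b)}` — the case of the `G`-valued γ-chain (`G = SU(N)`), where [6] Prop. 6's gauge needs no `U(1)` correction at all.
[cite: Balaban1985RegularSpaces, Prop. 6 p.99, p.76 («G = SU(N)»); Balaban1985Averaging, (9) p.18, p.20; Balaban1985Variational, (152) p.301] -/
theorem exists_suGauge_of_specialUnitaryGauge_local {d : ℕ} (lo hi : B7Prop1Explicit.Site d) {η : ℝ} (hη : 0 < η)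
    (V : B7Prop1Explicit.Site d → Fin d → (MatA N)ˣ) (g : B7Prop1Explicit.Site d → (MatA N)ˣ) (A : B7Prop1Explicit.Site d → Fin d → MatA N) {τ : ℝ}
    (hV : ∀ x μ, InBox lo hi x → InBox lo hi (x + e μ) → ((V x μ : (MatA N)ˣ) : MatA N).det = 1)
    (hg : ∀ x, InBox lo hi x → g x ∈ specialUnitaryUnits (Fin N))
    (hgauge : ∀ x μ, InBox lo hi x → InBox lo hi (x + e μ) → B7Prop1Explicit.gaugeAct g V x μ = cfgExp η A x μ)
    (hsa : ∀ x μ, InBox lo hi x → InBox lo hi (x + e μ) → IsSelfAdjoint (A x μ))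
    (hA : ∀ x μ, InBox lo hi x → InBox lo hi (x + e μ) → η * (N * ‖A x μ‖) ≤ τ)
    (hsmall : 4 * τ < 2 * Real.pi) :
    ∃ s : B7Prop1Explicit.Site d → Matrix.specialUnitaryGroup (Fin N) ℂ,
      (∀ y, InBox lo hi y → ιSU N (s y) = g y) ∧
      (∀ x μ, InBox lo hi x → InBox lo hi (x + e μ) → (A x μ).trace = 0) ∧
      (∀ x μ, InBox lo hi x → InBox lo hi (x + e μ) → B7Prop1Explicit.gaugeAct (fun y => ιSU N (s y)) V x μ = cfgExp η A x μ) := by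
  classical
  let s : B7Prop1Explicit.Site d → Matrix.specialUnitaryGroup (Fin N) ℂ := fun y =>
    if h : ∀ i, lo i ≤ y i ∧ y i ≤ hi i then ⟨((g y : (MatA N)ˣ) : MatA N), mem_specialUnitaryUnits.1 (hg y h)⟩ else 1
  have hs : ∀ y, InBox lo hi y → ιSU N (s y) = g y := by
    intro y hy
    apply Units.ext
    rw [coe_ιSU]
    simp only [s, dif_pos ((inBox_iff_forall'' lo hi y).1 hy)]
  have htr : ∀ x μ, InBox lo hi x → InBox lo hi (x + e μ) → (A x μ).trace = 0 := fun x μ hx hx' =>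
    trace_eq_zero_of_gauge_su hη V g A x μ (hV x μ hx hx') (Matrix.mem_specialUnitaryGroup_iff.1 (mem_specialUnitaryUnits.1 (hg x hx))).2
      (Matrix.mem_specialUnitaryGroup_iff.1 (mem_specialUnitaryUnits.1 (hg _ hx'))).2 (hgauge x μ hx hx') (hsa x μ hx hx') (hA x μ hx hx') hsmall
  refine ⟨s, hs, htr, fun x μ hx hx' => ?_⟩
  simp only [B7Prop1Explicit.gaugeAct]
  rw [hs x hx, hs (x + e μ) hx']
  exact hgauge x μ hx hx'

end Matrices

end Literature.MathematicalPhysics.QuantumFieldTheory.Balaban1983to89.Node00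

end
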